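import Literature.MathematicalPhysics.QuantumFieldTheory.Balaban1983to89.B9Eq34CurlGaugeModeTwoBackgrounds
import Literature.MathematicalPhysics.QuantumFieldTheory.Balaban1983to89.B9Ineq369CurvatureTwoBackgroundsPlaquette
import Literature.MathematicalPhysics.QuantumFieldTheory.Balaban1983to89.B9Eq373DerivativeRemainderTwoBackgrounds
import Literature.MathematicalPhysics.QuantumFieldTheory.Balaban1983to89.B9Eq384RemainderLetters

/-!
# `Balaban1983to89.B9Eq310HessianModePairingTwoBackgrounds` — T. Bałaban, *Propagators for lattice gauge theories in a background field*, Commun. Math. Phys.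
# **99** (1985) 389–434 [Balaban1985BackgroundPropagators] (3.10) p. 392, (3.4) p. 391, (3.36) p. 396, (3.69) p. 404, (3.120) p. 419: **THE HESSIAN `Δ^η = D*D + Δ′`
# AGAINST GAUGE MODES, DIFFERENCED BETWEEN TWO SMALL BACKGROUNDS — THE POLARISED PAIRING, THREE ABSTRACT DIFFERENCED PAIRINGS, AND THE `η`-FREE LETTERS AT THE
# CHAIN's WINDOWS** (supplier of the two-background θ-assembly `B9Eq3120DeltaPiPrimeFormTwoBackgrounds`, storey (T3) of the two-background («(b3)») θ-letter of
# the row OWNER's `Δ_π` port; (T1) = `B9Eq34CurlGaugeModeTwoBackgrounds`, (T2) = `B9Eq325GaugeModeLetterTwoBackgrounds`)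

statement-level skeleton of published theorems with citation tags; proofs where landed; nothing here is a claim about the Yang–Mills mass gap

PDF held: `paper:balaban1985-cmp99-background-propagators` (journal page = PDF page + 388), pp. 390–392, 396, 404, 419 — read by this lineage first-hand (gens 73–78:
p0003–p0004, p0008, p0016, p0031) and through the verbatim quotations of the suppliers named below.

CITATION HEADER (lean-in-tree rule 2026-08-18).  Audit cell `pub-balaban`, sub-cell `t4`, NE9 crux team (2): LEAF PROVER 04 (`b2b-balaban-t4-ne9-formalise-leaf-04`
gen 79), INTENT-1a (supplier half of INTENT-1, split for the 400-line rule).  WHY (cell context; DIAGNOSIS D-ne9p1-g87-1, the OWNER t4-ne9-p1's `Δ_π` port, his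
GO `CLAIMS.log` l.53352 W-9 (α)): the θ-letter of print's slot `π†Δ^ηπ` (the OWNER's `B9Eq3120DeltaPiPrimeFormDiagonal`, NE9 leaf-02's `B9Eq34CurlGaugeModeWindow`)
pairs the Hessian (3.10) with pure gauge modes `K_X = D_Xλ_X`; NE9 compares TWO coupling histories, i.e. two small backgrounds `U`, `V`, so every such pairing
must be DIFFERENCED `U − V` to first order in the closeness `δ`.  This file isolates the algebra (which is background-generic) from the assembly.

THE PRINT.  p. 392 (3.10) `Δ = D*D + Δ′` and (verbatim via `B9Ineq369CurvatureSmall`) *«with our assumptions on the configuration U the operator Δ′ will be a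
bounded, small operator»*; p. 391 (3.3)–(3.4) the covariant derivative and curl; p. 396 (3.35)–(3.36) the small-field windows (paraphrase); p. 419 (3.120)
(paraphrase): the defect `Δ′_π` collects the pairings of `Δ` with the gauge modes `DG′RD*`.  Print controls the background dependence by analyticity (Thm 3.4
p. 400); the cell reads it as Lipschitz continuity between two points of the small-field ball.

WHAT IS PROVED (sorry-free; proof lane — no `def`, no `Prop` placeholder; [folklore] one polarisation identity + Cauchy–Schwarz over landed letters).
* §1 **`inner_hessOp_eq`** — `⟨x, Δ^η(X)y⟩ = ⟨curl_Xx, curl_Xy⟩ + ⟨x, Δ′(X)y⟩` for mutually adjoint transporters (`hRS`; `principalOpK_eq_comp`,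
  `covCoCurlL2K_comp_eq_adjoint_comp`).
* §2 ABSTRACT DIFFERENCED PAIRINGS (any bond fields; the scalar letters `c_s` (curl closeness), `c_v` (curvature form), `c_v′` (curvature closeness) and the
  four sizes `t₁…t₄` as hypotheses): **`norm_inner_hessOp_mode_sub_le`** — `⟨x, Δ_Uk_U⟩ − ⟨x, Δ_Vk_V⟩ = ⟨curl_Ux, curl_Uk_U − curl_Vk_V⟩ + ⟨curl_Ux − curl_Vx,
  curl_Vk_V⟩ + ⟨x, (Δ′_U − Δ′_V)k_U⟩ + ⟨x, Δ′_V(k_U − k_V)⟩`, so `≤ ‖curl_Ux‖t₁ + c_s‖x‖t₂ + c_v′t₃‖x‖ + c_vt₄‖x‖`; **`norm_inner_mode_hessOp_sub_le`** (the left-mode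
  twin `⟨k_U, Δ_Uy⟩ − ⟨k_V, Δ_Vy⟩`); **`norm_inner_hessOp_mode_le`** (one background: `|⟨x, Δ_Vk⟩| ≤ ‖curl_Vx‖t₂ + c_vt₃‖x‖`).
* §3 THE LETTERS AT THE CHAIN's WINDOWS, `η`-FREE (`0 < η ≤ 1`, `0 ≤ α ≤ 1`, `0 ≤ δ`, `U(b), V(b) ∈ U1`): **`norm_adTransportW_sub_adTransportW_le`** (generic-torus
  copy of `B9Eq368RLipschitzTwoBackgrounds`' transporter closeness `2M_φM_φ′‖U(b) − V(b)‖`); **`norm_covCurlL2K_sub_le_closeness`** `‖curl_Uw − curl_Vw‖ ≤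
  8√dM_φM_φ′·δ‖w‖` (`B9Eq373DerivativeRemainderTwoBackgrounds.norm_covCurlL2K_sub_le₂`); **`norm_covCurlL2K_le_weight`** `‖curl_Uw‖ ≤ (1 + 8√dM_φM_φ′)N₁(w)` for any
  weight dominating `‖w‖` and `‖curl₁w‖` (`B9Eq373DerivativeRemainderL2.norm_covCurlL2K_sub_le`); **`norm_inner_curvOp_le_window`** `|⟨x, Δ′(U)y⟩| ≤ 32dC_τM_φ²ρ_w·α‖y‖‖x‖`
  (`B9Ineq369CurvatureOperatorBound.norm_inner_curvOp_le`); **`norm_inner_curvOp_sub_le_window`** `|⟨y, (Δ′(U) − Δ′(V))x⟩| ≤ 240dC_τM_φ²ρ_w·δ‖x‖‖y‖`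
  (`B9Ineq369CurvatureTwoBackgroundsPlaquette.norm_inner_curvOp_sub_le_of_plaq`; `η⁻²(12·δη·αη² + 3δη²) = δ(12αη + 3) ≤ 15δ`);
  **`norm_covCurl_covDeriv_sub_le_window₂`** `‖curl_U(D_Ul) − curl_V(D_Vl′)‖ ≤ 2M_φ′M_φ√#DirPair·(5δ‖l‖ + α‖l − l′‖)` ((T1)
  `B9Eq34CurlGaugeModeTwoBackgrounds.norm_covCurlL2K_covDerivL2K_sub_le_window`, `1 + 4αη ≤ 5`, plus leaf-02's `norm_covCurlL2K_covDerivL2K_le_window` at `V` on `l − l′`).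
MODEL ∕ DECLARED READINGS.  (M1) any torus `TSite d Pd`; fibre `W` read along `φ` (`M_φ`, `M_φ′`); weight `c₀`; scalar `η⁻¹`; trace `τ` with `‖τX‖ ≤ C_τ‖X‖`.
(M2) `hRS` (the unitary class), `U1`, the bond ∕ plaquette windows `αη` ∕ `αη²`, the closeness windows `δη` ∕ `δη²` and `|η|^d∕c₀ ≤ ρ_w` are HYPOTHESES.
HONEST SCOPE.  [folklore] algebra + Cauchy–Schwarz + window arithmetic; FIRST order between two small backgrounds; crude constants; nothing of [B9] asserted
beyond the suppliers; NOT the θ-assembly (next file), no `λ`-letters, no current `J`, no (3.117).  NOT summit progress (cell pub-balaban: NE9 NOT PRINTED ∕ NOT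
PROVED; «NE9 ⇐ the named binders»; row WALLED ON A MODEL (O-NE9-1; NEEDS-COORDINATOR #5 UNRULED); spine PROVED 0∕9; rung (B)+1 finite T⁴ — NOT infinite volume,
NOT mass gap, NOT BetaPertH, NOT Clay).  HONEST DEPENDENCY (cell line): continuum YM on T⁴ ⇐ BetaPertH ∧ nine spine estimates (0/9 proved); BetaPertH ⇐ (D1) ∧
(D4) ∧ CAP+tail; G-an2-4 gates asym, D1 and NE2/3/4.  NEW file; nothing modified.  Net new unproved facts: 0.
-/

noncomputable section

open scoped InnerProductSpace ComplexConjugate BigOperators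

namespace Literature.MathematicalPhysics.QuantumFieldTheory.Balaban1983to89.B9Eq310HessianModePairingTwoBackgrounds

open B4Sect5Torus (TSite)
open B9SectCLatticeCarrier (Bond DirPair)
open B11Eq103H1Complex (SiteL2K BondL2K covDerivL2K covDivL2K)
open B9Eq310HessianOperator (adTransportW adTransportW_apply hessOp hessOp_apply covCurlL2K principalOpK_eq_comp
  covCoCurlL2K_comp_eq_adjoint_comp curvOp)
open B9Eq310DeltaPrime (plaqHolU)
open B7Prop1Explicit (U1 mem_U1)
open B9Eq319QprimeLipschitzTwoBackgrounds (norm_conj_sub_conj_le_of_mem_U1)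
open B9Eq373DerivativeRemainderL2 (norm_covCurlL2K_sub_le)
open B9Eq373DerivativeRemainderTwoBackgrounds (norm_covCurlL2K_sub_le₂)
open B9Eq384RemainderLetters (norm_adTransportW_sub_le)
open B9Ineq369CurvatureOperatorBound (norm_inner_curvOp_le)
open B9Ineq369CurvatureTwoBackgroundsPlaquette (norm_inner_curvOp_sub_le_of_plaq)
open B9Eq34CurlGaugeModeWindow (norm_covCurlL2K_covDerivL2K_le_window)
open B9Eq34CurlGaugeModeTwoBackgrounds (norm_covCurlL2K_covDerivL2K_sub_le_window)

variable {d : ℕ} {Pd : Fin d → ℕ}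
  {𝔸 : Type*} [NormedRing 𝔸] [NormedAlgebra ℂ 𝔸] [NormOneClass 𝔸] [StarRing 𝔸] [NormedStarGroup 𝔸] [StarModule ℂ 𝔸]
  {W : Type*} [NormedAddCommGroup W] [InnerProductSpace ℂ W] [FiniteDimensional ℂ W] (φ : W ≃ₗ[ℂ] 𝔸) {c₀ : ℝ} [Fact (0 < c₀)]
  {Mφ Mφ' : ℝ}

/-! ## §1 The polarised Hessian pairing -/

omit [NormOneClass 𝔸] [NormedStarGroup 𝔸] in
/-- **`⟨x, Δ^η(X)y⟩ = ⟨curl_Xx, curl_Xy⟩ + ⟨x, Δ′(X)y⟩`** — (3.10) `Δ = D*D + Δ′` with `D* = D†` for mutually adjoint transporters (`hRS`).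
[cite: Balaban1985BackgroundPropagators, (3.10) p.392, (3.4) p.391, (3.9) p.392] -/
theorem inner_hessOp_eq (η : ℝ) (X : Bond d Pd → 𝔸ˣ) (τ : 𝔸 →ₗ[ℂ] ℂ)
    (hRS : ∀ (b : Bond d Pd) (v u : W), ⟪adTransportW φ X b v, u⟫_ℂ = ⟪v, adTransportW φ (fun b => (X b)⁻¹) b u⟫_ℂ)
    (x y : BondL2K ℂ d Pd c₀ W) :
    ⟪x, hessOp φ η X τ y⟫_ℂ =
      ⟪covCurlL2K ℂ c₀ ((η : ℂ))⁻¹ (adTransportW φ X) x, covCurlL2K ℂ c₀ ((η : ℂ))⁻¹ (adTransportW φ X) y⟫_ℂ + ⟪x, curvOp φ τ η X y⟫_ℂ := by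
  rw [hessOp_apply, inner_add_right, principalOpK_eq_comp,
    covCoCurlL2K_comp_eq_adjoint_comp _ (by rw [map_inv₀, Complex.conj_ofReal]) _ _ hRS, LinearMap.comp_apply, LinearMap.adjoint_inner_right]

/-! ## §2 Abstract differenced pairings (the scalar letters as hypotheses) -/

section Abstract

variable (η : ℝ) (U V : Bond d Pd → 𝔸ˣ) (τ : 𝔸 →ₗ[ℂ] ℂ)
  (hRSU : ∀ (b : Bond d Pd) (v u : W), ⟪adTransportW φ U b v, u⟫_ℂ = ⟪v, adTransportW φ (fun b => (U b)⁻¹) b u⟫_ℂ)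
  (hRSV : ∀ (b : Bond d Pd) (v u : W), ⟪adTransportW φ V b v, u⟫_ℂ = ⟪v, adTransportW φ (fun b => (V b)⁻¹) b u⟫_ℂ)
  {cs cv cv' : ℝ} (hcs0 : 0 ≤ cs) (hcv0 : 0 ≤ cv) (hcv'0 : 0 ≤ cv')
  (hcs : ∀ w : BondL2K ℂ d Pd c₀ W,
    ‖covCurlL2K ℂ c₀ ((η : ℂ))⁻¹ (adTransportW φ U) w - covCurlL2K ℂ c₀ ((η : ℂ))⁻¹ (adTransportW φ V) w‖ ≤ cs * ‖w‖)
  (hcvU : ∀ x y : BondL2K ℂ d Pd c₀ W, ‖⟪x, curvOp φ τ η U y⟫_ℂ‖ ≤ cv * ‖y‖ * ‖x‖)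
  (hcvV : ∀ x y : BondL2K ℂ d Pd c₀ W, ‖⟪x, curvOp φ τ η V y⟫_ℂ‖ ≤ cv * ‖y‖ * ‖x‖)
  (hcv' : ∀ y x : BondL2K ℂ d Pd c₀ W, ‖⟪y, curvOp φ τ η U x - curvOp φ τ η V x⟫_ℂ‖ ≤ cv' * ‖x‖ * ‖y‖)

omit [NormOneClass 𝔸] [NormedStarGroup 𝔸] in
include hRSU hRSV hcs0 hcv0 hcv'0 hcs hcvV hcv' in
/-- **THE HESSIAN AGAINST A GAUGE MODE, DIFFERENCED BETWEEN TWO BACKGROUNDS**: with `⟨x, Δ_Xk⟩ = ⟨curl_Xx, curl_Xk⟩ + ⟨x, Δ′_Xk⟩`,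
`⟨x, Δ_Uk_U⟩ − ⟨x, Δ_Vk_V⟩ = ⟨curl_Ux, curl_Uk_U − curl_Vk_V⟩ + ⟨curl_Ux − curl_Vx, curl_Vk_V⟩ + ⟨x, (Δ′_U − Δ′_V)k_U⟩ + ⟨x, Δ′_V(k_U − k_V)⟩`, hence
`≤ ‖curl_Ux‖t₁ + c_s‖x‖t₂ + c_v′t₃‖x‖ + c_vt₄‖x‖` given `‖curl_Uk_U − curl_Vk_V‖ ≤ t₁`, `‖curl_Vk_V‖ ≤ t₂`, `‖k_U‖ ≤ t₃`, `‖k_U − k_V‖ ≤ t₄`. [folklore]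
[cite: Balaban1985BackgroundPropagators, (3.10) p.392, (3.120) p.419] -/
theorem norm_inner_hessOp_mode_sub_le (x kU kV : BondL2K ℂ d Pd c₀ W) {t₁ t₂ t₃ t₄ : ℝ}
    (h₁ : ‖covCurlL2K ℂ c₀ ((η : ℂ))⁻¹ (adTransportW φ U) kU - covCurlL2K ℂ c₀ ((η : ℂ))⁻¹ (adTransportW φ V) kV‖ ≤ t₁)
    (h₂ : ‖covCurlL2K ℂ c₀ ((η : ℂ))⁻¹ (adTransportW φ V) kV‖ ≤ t₂) (h₃ : ‖kU‖ ≤ t₃) (h₄ : ‖kU - kV‖ ≤ t₄) :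
    ‖⟪x, hessOp φ η U τ kU⟫_ℂ - ⟪x, hessOp φ η V τ kV⟫_ℂ‖ ≤
      ‖covCurlL2K ℂ c₀ ((η : ℂ))⁻¹ (adTransportW φ U) x‖ * t₁ + cs * ‖x‖ * t₂ + cv' * t₃ * ‖x‖ + cv * t₄ * ‖x‖ := by
  have ht₂ : 0 ≤ t₂ := (norm_nonneg _).trans h₂
  rw [inner_hessOp_eq φ η U τ hRSU, inner_hessOp_eq φ η V τ hRSV]
  have e : ⟪covCurlL2K ℂ c₀ ((η : ℂ))⁻¹ (adTransportW φ U) x, covCurlL2K ℂ c₀ ((η : ℂ))⁻¹ (adTransportW φ U) kU⟫_ℂ + ⟪x, curvOp φ τ η U kU⟫_ℂ -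
      (⟪covCurlL2K ℂ c₀ ((η : ℂ))⁻¹ (adTransportW φ V) x, covCurlL2K ℂ c₀ ((η : ℂ))⁻¹ (adTransportW φ V) kV⟫_ℂ + ⟪x, curvOp φ τ η V kV⟫_ℂ) =
      ⟪covCurlL2K ℂ c₀ ((η : ℂ))⁻¹ (adTransportW φ U) x,
          covCurlL2K ℂ c₀ ((η : ℂ))⁻¹ (adTransportW φ U) kU - covCurlL2K ℂ c₀ ((η : ℂ))⁻¹ (adTransportW φ V) kV⟫_ℂ +
        ⟪covCurlL2K ℂ c₀ ((η : ℂ))⁻¹ (adTransportW φ U) x - covCurlL2K ℂ c₀ ((η : ℂ))⁻¹ (adTransportW φ V) x,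
          covCurlL2K ℂ c₀ ((η : ℂ))⁻¹ (adTransportW φ V) kV⟫_ℂ +
        ⟪x, curvOp φ τ η U kU - curvOp φ τ η V kU⟫_ℂ + ⟪x, curvOp φ τ η V (kU - kV)⟫_ℂ := by
    rw [map_sub, inner_sub_right, inner_sub_right, inner_sub_right, inner_sub_left]; ring
  rw [e]
  have b₁ := (norm_inner_le_norm (𝕜 := ℂ) (covCurlL2K ℂ c₀ ((η : ℂ))⁻¹ (adTransportW φ U) x)
    (covCurlL2K ℂ c₀ ((η : ℂ))⁻¹ (adTransportW φ U) kU - covCurlL2K ℂ c₀ ((η : ℂ))⁻¹ (adTransportW φ V) kV)).trans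
    (mul_le_mul_of_nonneg_left h₁ (norm_nonneg _))
  have b₂ := (norm_inner_le_norm (𝕜 := ℂ) (covCurlL2K ℂ c₀ ((η : ℂ))⁻¹ (adTransportW φ U) x - covCurlL2K ℂ c₀ ((η : ℂ))⁻¹ (adTransportW φ V) x)
    (covCurlL2K ℂ c₀ ((η : ℂ))⁻¹ (adTransportW φ V) kV)).trans (mul_le_mul (hcs x) h₂ (norm_nonneg _) (mul_nonneg hcs0 (norm_nonneg _)))
  have b₃ := (hcv' x kU).trans (mul_le_mul_of_nonneg_right (mul_le_mul_of_nonneg_left h₃ hcv'0) (norm_nonneg _))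
  have b₄ := (hcvV x (kU - kV)).trans (mul_le_mul_of_nonneg_right (mul_le_mul_of_nonneg_left h₄ hcv0) (norm_nonneg _))
  exact (norm_add_le _ _).trans (add_le_add ((norm_add_le _ _).trans (add_le_add ((norm_add_le _ _).trans (add_le_add b₁ b₂)) b₃)) b₄)

omit [NormOneClass 𝔸] [NormedStarGroup 𝔸] in
include hRSU hRSV hcv0 hcv'0 hcs hcvU hcv' in
/-- **THE LEFT-MODE TWIN**: `⟨k_U, Δ_Uy⟩ − ⟨k_V, Δ_Vy⟩ = ⟨curl_Uk_U − curl_Vk_V, curl_Uy⟩ + ⟨curl_Vk_V, curl_Uy − curl_Vy⟩ + ⟨k_U − k_V, Δ′_Uy⟩ + ⟨k_V, (Δ′_U − Δ′_V)y⟩`,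
hence `≤ t₁‖curl_Uy‖ + t₂c_s‖y‖ + c_vt₄‖y‖ + c_v′t₃‖y‖` given `‖curl_Uk_U − curl_Vk_V‖ ≤ t₁`, `‖curl_Vk_V‖ ≤ t₂`, `‖k_V‖ ≤ t₃`, `‖k_U − k_V‖ ≤ t₄`. [folklore]
[cite: Balaban1985BackgroundPropagators, (3.10) p.392, (3.120) p.419] -/
theorem norm_inner_mode_hessOp_sub_le (y kU kV : BondL2K ℂ d Pd c₀ W) {t₁ t₂ t₃ t₄ : ℝ}
    (h₁ : ‖covCurlL2K ℂ c₀ ((η : ℂ))⁻¹ (adTransportW φ U) kU - covCurlL2K ℂ c₀ ((η : ℂ))⁻¹ (adTransportW φ V) kV‖ ≤ t₁)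
    (h₂ : ‖covCurlL2K ℂ c₀ ((η : ℂ))⁻¹ (adTransportW φ V) kV‖ ≤ t₂) (h₃ : ‖kV‖ ≤ t₃) (h₄ : ‖kU - kV‖ ≤ t₄) :
    ‖⟪kU, hessOp φ η U τ y⟫_ℂ - ⟪kV, hessOp φ η V τ y⟫_ℂ‖ ≤
      t₁ * ‖covCurlL2K ℂ c₀ ((η : ℂ))⁻¹ (adTransportW φ U) y‖ + t₂ * (cs * ‖y‖) + cv * ‖y‖ * t₄ + cv' * ‖y‖ * t₃ := by
  have ht₂ : 0 ≤ t₂ := (norm_nonneg _).trans h₂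
  rw [inner_hessOp_eq φ η U τ hRSU, inner_hessOp_eq φ η V τ hRSV]
  have e : ⟪covCurlL2K ℂ c₀ ((η : ℂ))⁻¹ (adTransportW φ U) kU, covCurlL2K ℂ c₀ ((η : ℂ))⁻¹ (adTransportW φ U) y⟫_ℂ + ⟪kU, curvOp φ τ η U y⟫_ℂ -
      (⟪covCurlL2K ℂ c₀ ((η : ℂ))⁻¹ (adTransportW φ V) kV, covCurlL2K ℂ c₀ ((η : ℂ))⁻¹ (adTransportW φ V) y⟫_ℂ + ⟪kV, curvOp φ τ η V y⟫_ℂ) =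
      ⟪covCurlL2K ℂ c₀ ((η : ℂ))⁻¹ (adTransportW φ U) kU - covCurlL2K ℂ c₀ ((η : ℂ))⁻¹ (adTransportW φ V) kV,
          covCurlL2K ℂ c₀ ((η : ℂ))⁻¹ (adTransportW φ U) y⟫_ℂ +
        ⟪covCurlL2K ℂ c₀ ((η : ℂ))⁻¹ (adTransportW φ V) kV,
          covCurlL2K ℂ c₀ ((η : ℂ))⁻¹ (adTransportW φ U) y - covCurlL2K ℂ c₀ ((η : ℂ))⁻¹ (adTransportW φ V) y⟫_ℂ +
        ⟪kU - kV, curvOp φ τ η U y⟫_ℂ + ⟪kV, curvOp φ τ η U y - curvOp φ τ η V y⟫_ℂ := by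
    rw [inner_sub_right, inner_sub_right, inner_sub_left, inner_sub_left]; ring
  rw [e]
  have b₁ := (norm_inner_le_norm (𝕜 := ℂ) (covCurlL2K ℂ c₀ ((η : ℂ))⁻¹ (adTransportW φ U) kU - covCurlL2K ℂ c₀ ((η : ℂ))⁻¹ (adTransportW φ V) kV)
    (covCurlL2K ℂ c₀ ((η : ℂ))⁻¹ (adTransportW φ U) y)).trans (mul_le_mul_of_nonneg_right h₁ (norm_nonneg _))
  have b₂ := (norm_inner_le_norm (𝕜 := ℂ) (covCurlL2K ℂ c₀ ((η : ℂ))⁻¹ (adTransportW φ V) kV)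
    (covCurlL2K ℂ c₀ ((η : ℂ))⁻¹ (adTransportW φ U) y - covCurlL2K ℂ c₀ ((η : ℂ))⁻¹ (adTransportW φ V) y)).trans
    (mul_le_mul h₂ (hcs y) (norm_nonneg _) ht₂)
  have b₃ := (hcvU (kU - kV) y).trans (mul_le_mul_of_nonneg_left h₄ (mul_nonneg hcv0 (norm_nonneg _)))
  have b₄ := (hcv' kV y).trans (mul_le_mul_of_nonneg_left h₃ (mul_nonneg hcv'0 (norm_nonneg _)))
  exact (norm_add_le _ _).trans (add_le_add ((norm_add_le _ _).trans (add_le_add ((norm_add_le _ _).trans (add_le_add b₁ b₂)) b₃)) b₄)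

omit [NormOneClass 𝔸] [NormedStarGroup 𝔸] in
include hRSV hcv0 hcvV in
/-- **ONE BACKGROUND**: `|⟨x, Δ_Vk⟩| ≤ ‖curl_Vx‖t₂ + c_vt₃‖x‖` given `‖curl_Vk‖ ≤ t₂`, `‖k‖ ≤ t₃` (the shape of the OWNER's `hmode`). [folklore]
[cite: Balaban1985BackgroundPropagators, (3.10) p.392, (3.120) p.419] -/
theorem norm_inner_hessOp_mode_le (x k : BondL2K ℂ d Pd c₀ W) {t₂ t₃ : ℝ}
    (h₂ : ‖covCurlL2K ℂ c₀ ((η : ℂ))⁻¹ (adTransportW φ V) k‖ ≤ t₂) (h₃ : ‖k‖ ≤ t₃) :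
    ‖⟪x, hessOp φ η V τ k⟫_ℂ‖ ≤ ‖covCurlL2K ℂ c₀ ((η : ℂ))⁻¹ (adTransportW φ V) x‖ * t₂ + cv * t₃ * ‖x‖ := by
  rw [inner_hessOp_eq φ η V τ hRSV]
  have b₁ := (norm_inner_le_norm (𝕜 := ℂ) (covCurlL2K ℂ c₀ ((η : ℂ))⁻¹ (adTransportW φ V) x) (covCurlL2K ℂ c₀ ((η : ℂ))⁻¹ (adTransportW φ V) k)).trans
    (mul_le_mul_of_nonneg_left h₂ (norm_nonneg _))
  have b₂ := (hcvV x k).trans (mul_le_mul_of_nonneg_right (mul_le_mul_of_nonneg_left h₃ hcv0) (norm_nonneg _))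
  exact (norm_add_le _ _).trans (add_le_add b₁ b₂)

end Abstract

/-! ## §3 The letters at the chain's windows (`η`-free) -/

section Letters

variable (hMφ : 0 ≤ Mφ) (hMφ' : 0 ≤ Mφ') (hφ : ∀ w, ‖φ w‖ ≤ Mφ * ‖w‖) (hφ' : ∀ X, ‖φ.symm X‖ ≤ Mφ' * ‖X‖)
  {η : ℝ} (hη : 0 < η) (hη1 : η ≤ 1) {U V : Bond d Pd → 𝔸ˣ} (hUb : ∀ b, U b ∈ U1 𝔸) (hVb : ∀ b, V b ∈ U1 𝔸)
  {α δ : ℝ} (hα0 : 0 ≤ α) (hα1 : α ≤ 1) (hδ0 : 0 ≤ δ)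

omit [StarRing 𝔸] [NormedStarGroup 𝔸] [StarModule ℂ 𝔸] [FiniteDimensional ℂ W] [Fact (0 < c₀)] in
/-- **the fibre transporters of two `U1`-valued backgrounds are `2M_φM_φ′‖U(b) − V(b)‖`-close** (the two-unitary conjugation letter read through `φ`; the
generic-torus copy of `B9Eq368RLipschitzTwoBackgrounds.norm_adTransportW_sub_adTransportW_le`). [cite: Balaban1985BackgroundPropagators, p.390, (3.70) p.404] -/
theorem norm_adTransportW_sub_adTransportW_le (hφ : ∀ w, ‖φ w‖ ≤ Mφ * ‖w‖) (hφ' : ∀ X, ‖φ.symm X‖ ≤ Mφ' * ‖X‖) (hMφ' : 0 ≤ Mφ')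
    (U V : Bond d Pd → 𝔸ˣ) (b : Bond d Pd) (hU : U b ∈ U1 𝔸) (hV : V b ∈ U1 𝔸) {δ₁ : ℝ} (hδ : ‖(U b : 𝔸) - (V b : 𝔸)‖ ≤ δ₁) (w : W) :
    ‖adTransportW φ U b w - adTransportW φ V b w‖ ≤ 2 * Mφ * Mφ' * δ₁ * ‖w‖ := by
  have hδ₁ : 0 ≤ δ₁ := (norm_nonneg _).trans hδ
  have hMφw : 0 ≤ Mφ * ‖w‖ := (norm_nonneg _).trans (hφ w)
  rw [adTransportW_apply, adTransportW_apply, ← map_sub]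
  calc _ ≤ Mφ' * ‖(U b : 𝔸) * φ w * ((U b)⁻¹ : 𝔸ˣ) - (V b : 𝔸) * φ w * ((V b)⁻¹ : 𝔸ˣ)‖ := hφ' _
    _ ≤ Mφ' * (2 * ‖(U b : 𝔸) - (V b : 𝔸)‖ * ‖φ w‖) := mul_le_mul_of_nonneg_left (norm_conj_sub_conj_le_of_mem_U1 hU hV _) hMφ'
    _ ≤ Mφ' * (2 * δ₁ * (Mφ * ‖w‖)) := by gcongr; exact hφ w
    _ = 2 * Mφ * Mφ' * δ₁ * ‖w‖ := by ring

omit [StarRing 𝔸] [NormedStarGroup 𝔸] [StarModule ℂ 𝔸] [FiniteDimensional ℂ W] in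
include hMφ hMφ' hφ hφ' hη hUb hVb hδ0 in
/-- **the two-background curl letter at the closeness window**: `‖curl_Uw − curl_Vw‖ ≤ 8√dM_φM_φ′·δ·‖w‖` for `‖U(b) − V(b)‖ ≤ δη` at the scalar `η⁻¹`
(`B9Eq373DerivativeRemainderTwoBackgrounds.norm_covCurlL2K_sub_le₂`; the power of `η⁻¹` is paid by the window). [cite: Balaban1985BackgroundPropagators, (3.4) p.391, (3.70)–(3.73) pp.404–405] -/
theorem norm_covCurlL2K_sub_le_closeness (hUV : ∀ b, ‖(U b : 𝔸) - (V b : 𝔸)‖ ≤ δ * η) (w : BondL2K ℂ d Pd c₀ W) :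
    ‖covCurlL2K ℂ c₀ ((η : ℂ))⁻¹ (adTransportW φ U) w - covCurlL2K ℂ c₀ ((η : ℂ))⁻¹ (adTransportW φ V) w‖ ≤ 8 * Real.sqrt d * (Mφ * Mφ') * δ * ‖w‖ := by
  have hRR' : ∀ (b : Bond d Pd) (x : W), ‖adTransportW φ U b x - adTransportW φ V b x‖ ≤ (2 * Mφ * Mφ' * (δ * η)) * ‖x‖ := fun b x =>
    norm_adTransportW_sub_adTransportW_le φ hφ hφ' hMφ' U V b (hUb b) (hVb b) (hUV b) x
  have h := norm_covCurlL2K_sub_le₂ (c₀ := c₀) ((η : ℂ))⁻¹ (by positivity : 0 ≤ 2 * Mφ * Mφ' * (δ * η)) hRR' w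
  have hηn : ‖((η : ℂ))⁻¹‖ * η = 1 := by rw [norm_inv, Complex.norm_real, Real.norm_eq_abs, abs_of_pos hη, inv_mul_cancel₀ hη.ne']
  refine h.trans_eq ?_
  calc _ = 8 * Real.sqrt d * (Mφ * Mφ') * δ * (‖((η : ℂ))⁻¹‖ * η) * ‖w‖ := by ring
    _ = _ := by rw [hηn, mul_one]

omit [StarRing 𝔸] [NormedStarGroup 𝔸] [StarModule ℂ 𝔸] [FiniteDimensional ℂ W] in
include hMφ hMφ' hφ hφ' hη hUb hα0 hα1 in
/-- **the curl at `U` against the flat weight**: `‖curl_Uw‖ ≤ (1 + 8√dM_φM_φ′)·N₁(w)` under the bond window `‖U(b) − 1‖ ≤ αη`, `α ≤ 1`, for any weight with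
`‖w‖ ≤ N₁(w)`, `‖curl₁w‖ ≤ N₁(w)` (`B9Eq373DerivativeRemainderL2.norm_covCurlL2K_sub_le`). [cite: Balaban1985BackgroundPropagators, (3.4) p.391, (3.35) p.396, (3.73) p.405] -/
theorem norm_covCurlL2K_le_weight (hUη : ∀ b, ‖(U b : 𝔸) - 1‖ ≤ α * η) (N : BondL2K ℂ d Pd c₀ W → ℝ) (hNn : ∀ z, ‖z‖ ≤ N z)
    (hNc : ∀ z, ‖covCurlL2K ℂ c₀ ((η : ℂ))⁻¹ (adTransportW φ (fun _ : Bond d Pd => (1 : 𝔸ˣ))) z‖ ≤ N z) (w : BondL2K ℂ d Pd c₀ W) :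
    ‖covCurlL2K ℂ c₀ ((η : ℂ))⁻¹ (adTransportW φ U) w‖ ≤ (1 + 8 * Real.sqrt d * (Mφ * Mφ')) * N w := by
  have hR : ∀ (b : Bond d Pd) (x : W), ‖adTransportW φ U b x - x‖ ≤ 2 * Mφ * Mφ' * (α * η) * ‖x‖ := fun b x =>
    norm_adTransportW_sub_le φ hφ hφ' hMφ' U b (hUb b) (hUη b) x
  have hR₁ : ∀ (b : Bond d Pd) (x : W), adTransportW φ (fun _ : Bond d Pd => (1 : 𝔸ˣ)) b x = x := fun b x => by
    rw [adTransportW_apply]; simp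
  have h := norm_covCurlL2K_sub_le (c₀ := c₀) ((η : ℂ))⁻¹ (by positivity : 0 ≤ 2 * Mφ * Mφ' * (α * η)) hR hR₁ w
  have hηn : ‖((η : ℂ))⁻¹‖ * η = 1 := by rw [norm_inv, Complex.norm_real, Real.norm_eq_abs, abs_of_pos hη, inv_mul_cancel₀ hη.ne']
  have h2 : 4 * Real.sqrt d * (‖((η : ℂ))⁻¹‖ * (2 * Mφ * Mφ' * (α * η))) = 8 * Real.sqrt d * (Mφ * Mφ') * α := by
    calc _ = 8 * Real.sqrt d * (Mφ * Mφ') * α * (‖((η : ℂ))⁻¹‖ * η) := by ring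
      _ = _ := by rw [hηn, mul_one]
  rw [h2] at h
  have h3 : ‖covCurlL2K ℂ c₀ ((η : ℂ))⁻¹ (adTransportW φ U) w‖ ≤
      ‖covCurlL2K ℂ c₀ ((η : ℂ))⁻¹ (adTransportW φ (fun _ : Bond d Pd => (1 : 𝔸ˣ))) w‖ + 8 * Real.sqrt d * (Mφ * Mφ') * α * ‖w‖ :=
    (norm_le_insert' _ _).trans (add_le_add le_rfl h)
  have h4 : 8 * Real.sqrt d * (Mφ * Mφ') * α * ‖w‖ ≤ 8 * Real.sqrt d * (Mφ * Mφ') * N w := by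
    have h8 : 0 ≤ 8 * Real.sqrt d * (Mφ * Mφ') := by positivity
    have : α * ‖w‖ ≤ 1 * N w := mul_le_mul hα1 (hNn w) (norm_nonneg _) zero_le_one
    calc _ = 8 * Real.sqrt d * (Mφ * Mφ') * (α * ‖w‖) := by ring
      _ ≤ 8 * Real.sqrt d * (Mφ * Mφ') * (1 * N w) := mul_le_mul_of_nonneg_left this h8
      _ = _ := by ring
  calc _ ≤ N w + 8 * Real.sqrt d * (Mφ * Mφ') * N w := h3.trans (add_le_add (hNc w) h4)
    _ = (1 + 8 * Real.sqrt d * (Mφ * Mφ')) * N w := by ring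

variable {τ : 𝔸 →ₗ[ℂ] ℂ} {Cτ : ℝ} (hτ : ∀ X, ‖τ X‖ ≤ Cτ * ‖X‖) (hCτ : 0 ≤ Cτ) {ρw : ℝ} (hρ : |η| ^ d / c₀ ≤ ρw)

include hτ hCτ hφ hMφ hUb hα0 hρ hη in
/-- **the curvature form at the plaquette window**: `|⟨x, Δ′(U)y⟩| ≤ 32dC_τM_φ²ρ_w·α·‖y‖‖x‖` for `‖U(∂p) − 1‖ ≤ αη²`, `|η|^d∕c₀ ≤ ρ_w`
(`B9Ineq369CurvatureOperatorBound.norm_inner_curvOp_le`; both powers of `η⁻¹` paid by the window). [cite: Balaban1985BackgroundPropagators, p.392, (3.69) p.404, (3.35) p.396] -/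
theorem norm_inner_curvOp_le_window (hpl : ∀ p : B9SectCLatticeCarrier.Plaq d Pd, ‖(plaqHolU U p : 𝔸) - 1‖ ≤ α * η ^ 2) (x y : BondL2K ℂ d Pd c₀ W) :
    ‖⟪x, curvOp φ τ η U y⟫_ℂ‖ ≤ 32 * d * Cτ * Mφ ^ 2 * ρw * α * ‖y‖ * ‖x‖ := by
  have hc₀ : 0 < c₀ := Fact.out
  have hU1 : ∀ b : Bond d Pd, ‖(U b : 𝔸)‖ ≤ 1 ∧ ‖(((U b)⁻¹ : 𝔸ˣ) : 𝔸)‖ ≤ 1 := fun b => mem_U1.1 (hUb b)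
  have h := norm_inner_curvOp_le φ hτ hCτ hφ η hU1 hpl hMφ (by positivity : 0 ≤ α * η ^ 2) x y
  have hn : ‖((η : ℂ))⁻¹‖ ^ 2 * (α * η ^ 2) = α := by
    rw [norm_inv, Complex.norm_real, Real.norm_eq_abs, inv_pow, sq_abs]; field_simp
  rw [hn] at h
  have hρw0 : 0 ≤ ρw := le_trans (by positivity) hρ
  have : 32 * d * Cτ * Mφ ^ 2 * (|η| ^ d / c₀) * α ≤ 32 * d * Cτ * Mφ ^ 2 * ρw * α :=
    mul_le_mul_of_nonneg_right (mul_le_mul_of_nonneg_left hρ (by positivity)) hα0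
  exact h.trans (by nlinarith [this, mul_nonneg (norm_nonneg y) (norm_nonneg x)])

include hτ hCτ hφ hMφ hUb hVb hα0 hα1 hδ0 hρ hη hη1 in
/-- **the two-background curvature form at the windows**: `|⟨y, (Δ′(U) − Δ′(V))x⟩| ≤ 240dC_τM_φ²ρ_w·δ·‖x‖‖y‖` for `‖U(b) − V(b)‖ ≤ δη`, `‖U(∂p) − V(∂p)‖ ≤ δη²`,
`‖U(∂p) − 1‖ ≤ αη²` (`B9Ineq369CurvatureTwoBackgroundsPlaquette.norm_inner_curvOp_sub_le_of_plaq`: `η⁻²(12·δη·αη² + 3δη²) = δ(12αη + 3) ≤ 15δ`).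
[cite: Balaban1985BackgroundPropagators, p.392, (3.69) p.404, (3.35) p.396] -/
theorem norm_inner_curvOp_sub_le_window (hUV : ∀ b, ‖(U b : 𝔸) - (V b : 𝔸)‖ ≤ δ * η)
    (hpp : ∀ p : B9SectCLatticeCarrier.Plaq d Pd, ‖(plaqHolU U p : 𝔸) - (plaqHolU V p : 𝔸)‖ ≤ δ * η ^ 2)
    (hpl : ∀ p : B9SectCLatticeCarrier.Plaq d Pd, ‖(plaqHolU U p : 𝔸) - 1‖ ≤ α * η ^ 2) (y x : BondL2K ℂ d Pd c₀ W) :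
    ‖⟪y, curvOp φ τ η U x - curvOp φ τ η V x⟫_ℂ‖ ≤ 240 * d * Cτ * Mφ ^ 2 * ρw * δ * ‖x‖ * ‖y‖ := by
  have hc₀ : 0 < c₀ := Fact.out
  have hU1 : ∀ b : Bond d Pd, ‖(U b : 𝔸)‖ ≤ 1 ∧ ‖(((U b)⁻¹ : 𝔸ˣ) : 𝔸)‖ ≤ 1 := fun b => mem_U1.1 (hUb b)
  have hV1 : ∀ b : Bond d Pd, ‖(V b : 𝔸)‖ ≤ 1 ∧ ‖(((V b)⁻¹ : 𝔸ˣ) : 𝔸)‖ ≤ 1 := fun b => mem_U1.1 (hVb b)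
  have h := norm_inner_curvOp_sub_le_of_plaq φ hτ hCτ hφ η hU1 hV1 (by positivity : 0 ≤ δ * η) hUV (by positivity : 0 ≤ δ * η ^ 2) hpp
    (by positivity : 0 ≤ α * η ^ 2) hpl hMφ y x
  have hn : ‖((η : ℂ))⁻¹‖ ^ 2 * (12 * (δ * η) * (α * η ^ 2) + 3 * (δ * η ^ 2)) = δ * (12 * (α * η) + 3) := by
    rw [norm_inv, Complex.norm_real, Real.norm_eq_abs, inv_pow, sq_abs]; field_simp
  rw [hn] at h
  have hρw0 : 0 ≤ ρw := le_trans (by positivity) hρ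
  have hαη : α * η ≤ 1 := by nlinarith
  have h15 : δ * (12 * (α * η) + 3) ≤ 15 * δ := by nlinarith
  have : 16 * d * Cτ * Mφ ^ 2 * (|η| ^ d / c₀) * (δ * (12 * (α * η) + 3)) ≤ 16 * d * Cτ * Mφ ^ 2 * ρw * (15 * δ) :=
    mul_le_mul (mul_le_mul_of_nonneg_left hρ (by positivity)) h15 (by positivity) (by positivity)
  exact h.trans (by nlinarith [this, mul_nonneg (norm_nonneg x) (norm_nonneg y)])

omit [StarRing 𝔸] [NormedStarGroup 𝔸] [StarModule ℂ 𝔸] [FiniteDimensional ℂ W] in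
include hMφ hMφ' hφ hφ' hη hη1 hUb hVb hα0 hα1 hδ0 in
/-- **the holonomy commutator of two gauge modes, two backgrounds**: `‖curl_U(D_Ul) − curl_V(D_Vl′)‖ ≤ a·(5δ‖l‖ + α‖l − l′‖)`, `a = 2M_φ′M_φ√#DirPair`, from (T1)
`norm_covCurlL2K_covDerivL2K_sub_le_window` (`1 + 4αη ≤ 5`) and leaf-02's `norm_covCurlL2K_covDerivL2K_le_window` at `V` on `l − l′`.
[cite: Balaban1985BackgroundPropagators, (3.3)–(3.4) p.391, (3.35)–(3.36) p.396] -/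
theorem norm_covCurl_covDeriv_sub_le_window₂ (hUV : ∀ b, ‖(U b : 𝔸) - (V b : 𝔸)‖ ≤ δ * η)
    (hpp : ∀ p : B9SectCLatticeCarrier.Plaq d Pd, ‖(plaqHolU U p : 𝔸) - (plaqHolU V p : 𝔸)‖ ≤ δ * η ^ 2)
    (hplV : ∀ p : B9SectCLatticeCarrier.Plaq d Pd, ‖(plaqHolU V p : 𝔸) - 1‖ ≤ α * η ^ 2) (l l' : SiteL2K ℂ d Pd c₀ W) :
    ‖covCurlL2K ℂ c₀ ((η : ℂ))⁻¹ (adTransportW φ U) (covDerivL2K ℂ c₀ ((η : ℂ))⁻¹ (adTransportW φ U) l) -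
        covCurlL2K ℂ c₀ ((η : ℂ))⁻¹ (adTransportW φ V) (covDerivL2K ℂ c₀ ((η : ℂ))⁻¹ (adTransportW φ V) l')‖ ≤
      2 * (Mφ' * Mφ) * Real.sqrt (Fintype.card (DirPair d)) * (5 * δ * ‖l‖ + α * ‖l - l'‖) := by
  have h1 := norm_covCurlL2K_covDerivL2K_sub_le_window φ hMφ hMφ' hφ hφ' hη hUb hVb hα0 hδ0 hUV hpp hplV l
  have h2 := norm_covCurlL2K_covDerivL2K_le_window φ hMφ hMφ' hφ hφ' hη.ne' hVb hα0 hplV (l - l')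
  rw [map_sub, map_sub] at h2
  have e : covCurlL2K ℂ c₀ ((η : ℂ))⁻¹ (adTransportW φ U) (covDerivL2K ℂ c₀ ((η : ℂ))⁻¹ (adTransportW φ U) l) -
      covCurlL2K ℂ c₀ ((η : ℂ))⁻¹ (adTransportW φ V) (covDerivL2K ℂ c₀ ((η : ℂ))⁻¹ (adTransportW φ V) l') =
      (covCurlL2K ℂ c₀ ((η : ℂ))⁻¹ (adTransportW φ U) (covDerivL2K ℂ c₀ ((η : ℂ))⁻¹ (adTransportW φ U) l) -
        covCurlL2K ℂ c₀ ((η : ℂ))⁻¹ (adTransportW φ V) (covDerivL2K ℂ c₀ ((η : ℂ))⁻¹ (adTransportW φ V) l)) +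
      (covCurlL2K ℂ c₀ ((η : ℂ))⁻¹ (adTransportW φ V) (covDerivL2K ℂ c₀ ((η : ℂ))⁻¹ (adTransportW φ V) l) -
        covCurlL2K ℂ c₀ ((η : ℂ))⁻¹ (adTransportW φ V) (covDerivL2K ℂ c₀ ((η : ℂ))⁻¹ (adTransportW φ V) l')) := by abel
  rw [e]
  refine (norm_add_le _ _).trans ((add_le_add h1 h2).trans ?_)
  have ha : 0 ≤ 2 * (Mφ' * Mφ) * Real.sqrt (Fintype.card (DirPair d)) := by positivity
  have h5 : δ * (1 + 4 * α * η) * ‖l‖ ≤ 5 * δ * ‖l‖ := by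
    have hαη : α * η ≤ 1 := by nlinarith
    nlinarith [mul_nonneg hδ0 (norm_nonneg l)]
  nlinarith [mul_le_mul_of_nonneg_left h5 ha]

end Letters

end Literature.MathematicalPhysics.QuantumFieldTheory.Balaban1983to89.B9Eq310HessianModePairingTwoBackgrounds

end
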